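import Mathlib.LinearAlgebra.Matrix.Kronecker
import Literature.Computability.AlgebraicComplexity.MS2001FormEPolystableComplex
import HarnessLib

/-!
# GCT I §7: the symmetries of the form `E(X)` over an arbitrary commutative ring

Companion of `MS2001ClassVarieties.lean` (the form `msE F m k = E(X) = ∏_σ det_σ(X)` of GCT I §7,
K. D. Mulmuley, M. Sohoni, SIAM J. Comput. 31 (2001), authors' version (AV) p.30; the named fact
`MS2001_thm_7_3`, its stability over every algebraically closed field, still OPEN in the tree) and
of `MS2001FormEPolystableComplex.lean` (the same symmetries at `F = ℂ`, and `MS2001_thm_7_3_complex`).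
Theorem-only; no definitions (the relabelling permutations `MS2001Thm73.relabel ρ κ π` of the
complex file are reused).

GCT I, Prop. 7.1 (AV p.31, all.txt L2262–2285) describes the stabilizer `K ⊆ SL_{km²}` of `E(X)`:
its identity component is `S·T` with `S ≅ SL_m(F)` acting by `X ↦ AX` (eq. (12)) and `T` a torus of
column scalings, and `K/K⁰` contains the wreath product of `A_m` (or `S_m` up to sign) and `S_k`
permuting the columns. This file supplies, over ANY commutative ring `F` and in the tree's
coordinates (variables `(r, (i, j))` = row `r`, column block `i`, column `j` inside the block;
`linSubst A (X v) = ∑_u A u v • X u`), the EASY inclusion of Prop. 7.1 as explicit formulas: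

* `linSubst_kronecker_one_msE`: the row substitution `g ⊗ 1` (`X ↦ gᵀX` on the variable matrix)
  multiplies `E(X)` by `det g ^ (k^m)`; so `SL_m` on the rows fixes `E(X)`
  (`linSubst_kronecker_one_msE_of_det`), with `det (g ⊗ 1) = det g ^ (mk)`;
* `linSubst_diagonal_snd_msE`: the column torus `X^j_i ↦ t_{ij} X^j_i` multiplies `E(X)` by
  `(∏ t)^(k^(m-1))` (each column occurs in `k^{m-1}` of the factors `det_σ` —
  `prod_prod_apply_eq_pow`), with determinant `(∏ t)^m` (`det_diagonal_snd`); the row torus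
  `linSubst_diagonal_fst_msE`;
* `rename_relabel_msE` / `linSubst_relabel_permMatrix_msE`: the relabelling
  `(r,(i,j)) ↦ (ρ r, (κ i, π_i j))` multiplies `E(X)` by `(sign κ · sign ρ)^(k^m)`, and its
  permutation matrix has determinant `sign ρ^{mk} (sign κ^k ∏_i sign π_i)^m` (`sign_relabel`,
  `det_relabel_permMatrix`); hence the determinant-one, `E`-fixing relabellings
  `linSubst_relabel_permMatrix_msE_of_sign_eq` / `det_relabel_permMatrix_eq_one`;
* the actions of these matrices on elementary vectors (`kronecker_one_mulVec_single`,
  `permMatrix_symm_mulVec_single`) and the degree of `E(X)` over any ring (`msE_isHomogeneous`).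

These are the inputs of the irreducibility of the stabilizer representation
(`MS2001FormEStabilizerIrreducible.lean`) used for Thm. 7.3 over algebraically closed fields of any
characteristic. HONEST FRAMING: elementary multilinear algebra (Laplace expansion bookkeeping);
nothing here bears on the conjectures of GCT I §7 or on P versus NP / VP versus VNP.

## References

* [MulmuleySohoniSIAM2001] K. D. Mulmuley, M. Sohoni, *Geometric complexity theory I*, SIAM J.
  Comput. 31 (2001) 496–526, §7: definition of `E(X)` (AV p.30), Prop. 7.1 (AV p.31, eq. (12)),
  Prop. 7.2 (degrees).
* [HornJohnson2013] R. A. Horn, C. R. Johnson, *Matrix Analysis*, 2nd ed., CUP 2013, §0.9.5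
  (permutation matrices), §4.2–4.3 (Kronecker products: `det (A ⊗ B)`).
-/

noncomputable section

namespace Literature.Computability.AlgebraicComplexity

namespace MS2001FormE

open MvPolynomial MS2001Thm73
open scoped Kronecker

variable {F : Type*} [CommRing F] {m kk : ℕ}

/-! ## Counting: each column of `X` occurs in `k^(m-1)` of the factors `det_σ` -/

/-- **Each column `X^j_i` enters exactly `k^{m-1}` of the `k^m` factors `det_σ(X)`** (those with
`σ i = j`), in product form: `∏_σ ∏_i t (i, σ i) = (∏_{(i,j)} t (i,j))^(k^(m-1))` for any weights
`t` in a commutative monoid (the degree bookkeeping behind GCT I Prop. 7.2: `E(X)` has degree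
`k^{m-1}` in every column). [cite: MulmuleySohoniSIAM2001, §7 / Prop. 7.2 (the degree of E(X), AV p.31)] -/
theorem prod_prod_apply_eq_pow {M : Type*} [CommMonoid M] (t : Fin m × Fin kk → M) :
    ∏ s : Fin m → Fin kk, ∏ i, t (i, s i) = (∏ c, t c) ^ kk ^ (m - 1) := by
  rw [Finset.prod_comm]
  have hi : ∀ i : Fin m, ∏ s : Fin m → Fin kk, t (i, s i) = (∏ j, t (i, j)) ^ kk ^ (m - 1) := by
    intro i
    rw [Fintype.prod_equiv (Equiv.funSplitAt i (Fin kk)) (fun s => t (i, s i))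
      (fun p => t (i, p.1)) (fun s => by simp), Fintype.prod_prod_type]
    simp only [Finset.prod_const, Finset.card_univ, Fintype.card_fun, Fintype.card_fin,
      Fintype.card_subtype_compl, Fintype.card_unique]
    rw [Finset.prod_pow]
  simp_rw [hi]
  rw [Finset.prod_pow, ← Fintype.prod_prod_type]

/-! ## Homogeneity of `E(X)` over any commutative ring -/

/-- Each factor `det_σ(X)` is a form of degree `m` (a determinant of distinct variables).
[cite: MulmuleySohoniSIAM2001, §7 (definition of E(X), AV p.30)] -/
theorem det_X_isHomogeneous (s : Fin m → Fin kk) :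
    (Matrix.of fun r i : Fin m =>
      (X (r, (i, s i)) : MvPolynomial (Fin m × (Fin m × Fin kk)) F)).det.IsHomogeneous m := by
  rw [Matrix.det_apply]
  refine IsHomogeneous.sum _ _ _ fun π _ => ?_
  have := IsHomogeneous.prod (φ := fun i : Fin m =>
    (Matrix.of fun r i : Fin m => (X (r, (i, s i)) : MvPolynomial (Fin m × (Fin m × Fin kk)) F))
      (π i) i) Finset.univ (fun _ => 1) fun i _ => by
        simpa only [Matrix.of_apply] using isHomogeneous_X F (π i, (i, s i))
  rw [Units.smul_def, zsmul_eq_mul, ← map_intCast (C : F →+* MvPolynomial _ F)]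
  simp only [Finset.sum_const, smul_eq_mul, mul_one, Finset.card_univ, Fintype.card_fin] at this
  simpa only [zero_add] using (isHomogeneous_C _ _).mul this

/-- **`E(X)` is a form of degree `d = m·k^m`** over any commutative ring (`k^m` factors `det_σ`,
each of degree `m`; "Let d be the total degree of E(X)", AV p.31). The `ℂ`-instance is
`MS2001Thm73.isHomogeneous_msE`. [cite: MulmuleySohoniSIAM2001, §7 / Prop. 7.2 (the degree d of E(X), AV p.31)] -/
theorem msE_isHomogeneous (m kk : ℕ) : (msE F m kk).IsHomogeneous (m * kk ^ m) := by
  have h := IsHomogeneous.prod (φ := fun s : Fin m → Fin kk =>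
    (Matrix.of fun r i : Fin m => (X (r, (i, s i)) : MvPolynomial (Fin m × (Fin m × Fin kk)) F)).det)
    Finset.univ (fun _ => m) fun s _ => det_X_isHomogeneous (F := F) s
  simp only [Finset.sum_const, Finset.card_univ, Fintype.card_fun, Fintype.card_fin, smul_eq_mul]
    at h
  rw [mul_comm] at h
  exact h

/-! ## Row substitutions `g ⊗ 1`: `SL_m` on the rows (Prop. 7.1, eq. (12)) -/

/-- The row substitution `g ⊗ 1` on a variable: `X_{(r,c)} ↦ ∑_{r'} g_{r' r} X_{(r',c)}`.
[cite: MulmuleySohoniSIAM2001, Prop. 7.1 eq. (12) (AV p.31)] -/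
theorem linSubst_kronecker_one_X (g : Matrix (Fin m) (Fin m) F) (r : Fin m) (c : Fin m × Fin kk) :
    linSubst (Fin m × (Fin m × Fin kk)) F (g ⊗ₖ (1 : Matrix (Fin m × Fin kk) (Fin m × Fin kk) F))
        (X (r, c)) =
      ∑ r' : Fin m, g r' r • (X (r', c) : MvPolynomial (Fin m × (Fin m × Fin kk)) F) := by
  rw [linSubst_X, Fintype.sum_prod_type]
  refine Finset.sum_congr rfl fun r' _ => ?_
  simp only [Matrix.kronecker_apply, Matrix.one_apply, mul_ite, mul_one, mul_zero, ite_smul,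
    zero_smul, Finset.sum_ite_eq', Finset.mem_univ, if_true]

/-- **`SL_m` on the rows, with the factor of automorphy**: the row substitution `g ⊗ 1`
(`X ↦ gᵀ X` on the `m × km` variable matrix) multiplies `E(X)` by `(det g)^(k^m)` — each factor
`det_σ(X)` by `det g`. Any commutative ring. [cite: MulmuleySohoniSIAM2001, Prop. 7.1 eq. (12) (AV p.31)] -/
theorem linSubst_kronecker_one_msE (g : Matrix (Fin m) (Fin m) F) :
    linSubst (Fin m × (Fin m × Fin kk)) F (g ⊗ₖ (1 : Matrix (Fin m × Fin kk) (Fin m × Fin kk) F))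
        (msE F m kk) = C (g.det ^ kk ^ m) * msE F m kk := by
  have hdet : ∀ s : Fin m → Fin kk,
      linSubst (Fin m × (Fin m × Fin kk)) F (g ⊗ₖ (1 : Matrix (Fin m × Fin kk) (Fin m × Fin kk) F))
        (Matrix.of fun r i : Fin m =>
          (X (r, (i, s i)) : MvPolynomial (Fin m × (Fin m × Fin kk)) F)).det =
      C g.det * (Matrix.of fun r i : Fin m =>
          (X (r, (i, s i)) : MvPolynomial (Fin m × (Fin m × Fin kk)) F)).det := by
    intro s
    rw [AlgHom.map_det]
    have hmat : (linSubst (Fin m × (Fin m × Fin kk)) F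
        (g ⊗ₖ (1 : Matrix (Fin m × Fin kk) (Fin m × Fin kk) F))).mapMatrix
        (Matrix.of fun r i : Fin m =>
          (X (r, (i, s i)) : MvPolynomial (Fin m × (Fin m × Fin kk)) F)) =
        (C : F →+* MvPolynomial (Fin m × (Fin m × Fin kk)) F).mapMatrix g.transpose *
          Matrix.of fun r i : Fin m =>
            (X (r, (i, s i)) : MvPolynomial (Fin m × (Fin m × Fin kk)) F) := by
      ext r i
      simp only [AlgHom.mapMatrix_apply, Matrix.map_apply, Matrix.of_apply,
        linSubst_kronecker_one_X, Matrix.mul_apply, RingHom.mapMatrix_apply,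
        Matrix.transpose_apply, smul_eq_C_mul]
    rw [hmat, Matrix.det_mul, ← RingHom.map_det, Matrix.det_transpose]
  unfold msE
  rw [map_prod]
  simp_rw [hdet]
  rw [Finset.prod_mul_distrib, Finset.prod_const, Finset.card_univ, Fintype.card_fun,
    Fintype.card_fin, Fintype.card_fin, ← map_pow]

/-- **`SL_m` on the rows fixes `E(X)`**: `det g = 1 ⇒ (g ⊗ 1) · E(X) = E(X)`.
[cite: MulmuleySohoniSIAM2001, Prop. 7.1 eq. (12) (AV p.31)] -/
theorem linSubst_kronecker_one_msE_of_det {g : Matrix (Fin m) (Fin m) F} (hg : g.det = 1) :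
    linSubst (Fin m × (Fin m × Fin kk)) F (g ⊗ₖ (1 : Matrix (Fin m × Fin kk) (Fin m × Fin kk) F))
        (msE F m kk) = msE F m kk := by
  rw [linSubst_kronecker_one_msE, hg, one_pow, C_1, one_mul]

/-- `det (g ⊗ 1) = (det g)^(mk)`; in particular `g ⊗ 1 ∈ SL_{km²}` for `g ∈ SL_m`.
[cite: HornJohnson2013, §4.2 (determinant of a Kronecker product)] -/
theorem det_kronecker_one (g : Matrix (Fin m) (Fin m) F) :
    (g ⊗ₖ (1 : Matrix (Fin m × Fin kk) (Fin m × Fin kk) F)).det = g.det ^ (m * kk) := by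
  rw [Matrix.det_kronecker, Matrix.det_one, one_pow, mul_one, Fintype.card_prod, Fintype.card_fin,
    Fintype.card_fin]

/-- The row substitution `g ⊗ 1` on an elementary vector: `(g ⊗ 1) e_{(r₀,c₀)} = ∑_r g_{r r₀} e_{(r,c₀)}`,
i.e. its `(r,c)`-coordinate is `g r r₀` if `c = c₀` and `0` otherwise.
[cite: HornJohnson2013, §4.2 (Kronecker products)] -/
theorem kronecker_one_mulVec_single (g : Matrix (Fin m) (Fin m) F) (r₀ : Fin m)
    (c₀ : Fin m × Fin kk) (a : F) :
    (g ⊗ₖ (1 : Matrix (Fin m × Fin kk) (Fin m × Fin kk) F)).mulVec (Pi.single (r₀, c₀) a) =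
      fun v => if v.2 = c₀ then g v.1 r₀ * a else 0 := by
  funext v
  obtain ⟨r, c⟩ := v
  rw [Matrix.mulVec_single]
  simp only [Pi.smul_apply, Matrix.col_apply, Matrix.kronecker_apply, Matrix.one_apply,
    MulOpposite.smul_eq_mul_unop, MulOpposite.unop_op, mul_ite, mul_one, mul_zero, ite_mul,
    zero_mul]

/-! ## The column torus and the row torus (Prop. 7.1, the torus `T`) -/

/-- A diagonal substitution scales each variable (any commutative ring). [cite: MulmuleySohoniSIAM2001, §4 (linear substitutions)] -/
theorem linSubst_diagonal_X_eq_smul {σ : Type*} [Fintype σ] [DecidableEq σ] (β : σ → F) (v : σ) :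
    linSubst σ F (Matrix.diagonal β) (X v) = β v • X v := by
  rw [linSubst_X, Finset.sum_eq_single v (fun u _ huv => by
    rw [Matrix.diagonal_apply_ne _ huv, zero_smul]) (fun h => absurd (Finset.mem_univ v) h),
    Matrix.diagonal_apply_eq]

/-- **The column torus, with its character**: the substitution `X^j_i ↦ t_{(i,j)} X^j_i`
(diagonal, depending only on the column) multiplies `E(X)` by `(∏_{(i,j)} t_{(i,j)})^(k^(m-1))`
— the factor `det_σ` by `∏_i t_{(i, σ i)}`. Any commutative ring.
[cite: MulmuleySohoniSIAM2001, Prop. 7.1 (the torus T of the stabilizer, AV p.31)] -/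
theorem linSubst_diagonal_snd_msE (t : Fin m × Fin kk → F) :
    linSubst (Fin m × (Fin m × Fin kk)) F
        (Matrix.diagonal fun v : Fin m × (Fin m × Fin kk) => t v.2) (msE F m kk) =
      C ((∏ c, t c) ^ kk ^ (m - 1)) * msE F m kk := by
  have hdet : ∀ s : Fin m → Fin kk,
      linSubst (Fin m × (Fin m × Fin kk)) F
        (Matrix.diagonal fun v : Fin m × (Fin m × Fin kk) => t v.2)
        (Matrix.of fun r i : Fin m =>
          (X (r, (i, s i)) : MvPolynomial (Fin m × (Fin m × Fin kk)) F)).det =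
      C (∏ i, t (i, s i)) * (Matrix.of fun r i : Fin m =>
          (X (r, (i, s i)) : MvPolynomial (Fin m × (Fin m × Fin kk)) F)).det := by
    intro s
    rw [AlgHom.map_det]
    have hmat : (linSubst (Fin m × (Fin m × Fin kk)) F
        (Matrix.diagonal fun v : Fin m × (Fin m × Fin kk) => t v.2)).mapMatrix
        (Matrix.of fun r i : Fin m =>
          (X (r, (i, s i)) : MvPolynomial (Fin m × (Fin m × Fin kk)) F)) =
        (Matrix.of fun r i : Fin m =>
            (X (r, (i, s i)) : MvPolynomial (Fin m × (Fin m × Fin kk)) F)) *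
          Matrix.diagonal fun i => C (t (i, s i)) := by
      ext r i
      simp only [AlgHom.mapMatrix_apply, Matrix.map_apply, Matrix.of_apply,
        linSubst_diagonal_X_eq_smul, Matrix.mul_diagonal, smul_eq_C_mul, mul_comm]
    rw [hmat, Matrix.det_mul, Matrix.det_diagonal, ← map_prod, mul_comm]
  unfold msE
  rw [map_prod]
  simp_rw [hdet]
  rw [Finset.prod_mul_distrib, ← map_prod, prod_prod_apply_eq_pow]

/-- `det` of the column torus element: `(∏ t)^m`. [cite: MulmuleySohoniSIAM2001, Prop. 7.1 (the torus T, AV p.31)] -/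
theorem det_diagonal_snd (t : Fin m × Fin kk → F) :
    (Matrix.diagonal fun v : Fin m × (Fin m × Fin kk) => t v.2).det = (∏ c, t c) ^ m := by
  rw [Matrix.det_diagonal, Fintype.prod_prod_type]
  simp only [Finset.prod_const, Finset.card_univ, Fintype.card_fin]

/-- **The row torus**: `X_{(r,c)} ↦ s_r X_{(r,c)}` multiplies `E(X)` by `(∏ s)^(k^m)` (the
diagonal case of `linSubst_kronecker_one_msE`). [cite: MulmuleySohoniSIAM2001, Prop. 7.1 eq. (12) (AV p.31)] -/
theorem linSubst_diagonal_fst_msE (s : Fin m → F) :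
    linSubst (Fin m × (Fin m × Fin kk)) F
        (Matrix.diagonal fun v : Fin m × (Fin m × Fin kk) => s v.1) (msE F m kk) =
      C ((∏ r, s r) ^ kk ^ m) * msE F m kk := by
  have h : (Matrix.diagonal fun v : Fin m × (Fin m × Fin kk) => s v.1) =
      Matrix.diagonal s ⊗ₖ (1 : Matrix (Fin m × Fin kk) (Fin m × Fin kk) F) := by
    rw [← Matrix.diagonal_one, Matrix.diagonal_kronecker_diagonal]
    simp only [mul_one]
  rw [h, linSubst_kronecker_one_msE, Matrix.det_diagonal]

/-- `det` of the row torus element: `(∏ s)^(mk)`. [cite: MulmuleySohoniSIAM2001, Prop. 7.1 (AV p.31)] -/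
theorem det_diagonal_fst (s : Fin m → F) :
    (Matrix.diagonal fun v : Fin m × (Fin m × Fin kk) => s v.1).det = (∏ r, s r) ^ (m * kk) := by
  rw [Matrix.det_diagonal, Fintype.prod_prod_type]
  simp only [Finset.prod_const, Finset.card_univ, Fintype.card_prod, Fintype.card_fin]
  rw [Finset.prod_pow]

/-! ## The relabellings `(r,(i,j)) ↦ (ρ r, (κ i, π_i j))` (Prop. 7.1, the wreath product) -/

/-- Unfolding `MS2001Thm73.relabel`. [cite: MulmuleySohoniSIAM2001, Prop. 7.1 (AV p.31)] -/
theorem relabel_apply_eq (ρ κ : Equiv.Perm (Fin m)) (π : Fin m → Equiv.Perm (Fin kk))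
    (v : Fin m × (Fin m × Fin kk)) : relabel ρ κ π v = (ρ v.1, (κ v.2.1, π v.2.1 v.2.2)) := rfl

/-- A relabelling maps each factor `det_σ` to `sign κ · sign ρ · det_{σ'}`,
`σ' = relabelChoice κ π σ` (any commutative ring; the `ℂ` case is in
`MS2001FormEPolystableComplex.lean`). [cite: MulmuleySohoniSIAM2001, Prop. 7.1 (AV p.31)] -/
theorem rename_relabel_det (ρ κ : Equiv.Perm (Fin m)) (π : Fin m → Equiv.Perm (Fin kk))
    (σ : Fin m → Fin kk) :
    rename (relabel ρ κ π)
        (Matrix.of fun r c : Fin m =>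
          (X (r, (c, σ c)) : MvPolynomial (Fin m × (Fin m × Fin kk)) F)).det =
      ((Equiv.Perm.sign κ : ℤ) : MvPolynomial (Fin m × (Fin m × Fin kk)) F) *
        (((Equiv.Perm.sign ρ : ℤ) : MvPolynomial (Fin m × (Fin m × Fin kk)) F) *
          (Matrix.of fun r c : Fin m =>
            (X (r, (c, relabelChoice κ π σ c)) : MvPolynomial (Fin m × (Fin m × Fin kk)) F)).det) := by
  set B : Matrix (Fin m) (Fin m) (MvPolynomial (Fin m × (Fin m × Fin kk)) F) :=
    Matrix.of fun r c : Fin m => (X (r, (c, relabelChoice κ π σ c)) : MvPolynomial _ F) with hB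
  rw [AlgHom.map_det]
  have hmat : (rename (relabel ρ κ π)).mapMatrix
      (Matrix.of fun r c : Fin m => (X (r, (c, σ c)) : MvPolynomial (Fin m × (Fin m × Fin kk)) F)) =
      (B.submatrix ρ id).submatrix id κ := by
    ext r c
    simp only [AlgHom.mapMatrix_apply, Matrix.map_apply, Matrix.of_apply, rename_X,
      relabel_apply_eq, Matrix.submatrix_apply, id_eq, hB, relabelChoice]
    simp
  rw [hmat, Matrix.det_permute', Matrix.det_permute]

/-- **`E(X)` is a relative invariant of the relabellings, any commutative ring**:
`E(relabel X) = (sign κ · sign ρ)^{k^m} · E(X)` (GCT I Prop. 7.1: the wreath product of the row /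
column permutations inside the stabilizer, up to sign; the `ℂ` case is
`MS2001Thm73.rename_relabel_msE`). [cite: MulmuleySohoniSIAM2001, Prop. 7.1 (AV p.31, all.txt L2262)] -/
theorem rename_relabel_msE (ρ κ : Equiv.Perm (Fin m)) (π : Fin m → Equiv.Perm (Fin kk)) :
    rename (relabel ρ κ π) (msE F m kk) =
      C ((((Equiv.Perm.sign κ : ℤ) : F) * ((Equiv.Perm.sign ρ : ℤ) : F)) ^
          Fintype.card (Fin m → Fin kk)) * msE F m kk := by
  unfold msE
  rw [map_prod]
  simp_rw [rename_relabel_det ρ κ π]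
  rw [Finset.prod_mul_distrib, Finset.prod_mul_distrib, Finset.prod_const, Finset.prod_const,
    Finset.card_univ]
  rw [Fintype.prod_equiv (relabelChoice κ π)
    (fun σ => (Matrix.of fun r c : Fin m =>
      (X (r, (c, relabelChoice κ π σ c)) : MvPolynomial (Fin m × (Fin m × Fin kk)) F)).det)
    (fun σ' => (Matrix.of fun r c : Fin m =>
      (X (r, (c, σ' c)) : MvPolynomial (Fin m × (Fin m × Fin kk)) F)).det) (fun σ => rfl)]
  rw [← mul_assoc, ← mul_pow, map_pow, map_mul, map_intCast, map_intCast]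

/-- The relabelling as a product of Mathlib's product permutations (rows, then blocks and
in-block columns). [cite: MulmuleySohoniSIAM2001, Prop. 7.1 (AV p.31)] -/
theorem relabel_eq_prodCongr_mul (ρ κ : Equiv.Perm (Fin m)) (π : Fin m → Equiv.Perm (Fin kk)) :
    relabel ρ κ π =
      (Equiv.prodCongrLeft fun _ : Fin m × Fin kk => ρ) *
        Equiv.prodCongrRight fun _ : Fin m =>
          ((Equiv.prodCongrLeft fun _ : Fin kk => κ) * Equiv.prodCongrRight π) :=
  Equiv.ext fun _ => rfl

/-- **The sign of a relabelling**: `sign = sign ρ^{mk} · (sign κ^k · ∏_i sign π_i)^m` (stated in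
`ℤ`, where Mathlib's `Monoid` powers apply). [cite: MulmuleySohoniSIAM2001, Prop. 7.1 (AV p.31)] -/
theorem sign_relabel (ρ κ : Equiv.Perm (Fin m)) (π : Fin m → Equiv.Perm (Fin kk)) :
    ((Equiv.Perm.sign (relabel ρ κ π) : ℤˣ) : ℤ) =
      (Equiv.Perm.sign ρ : ℤ) ^ (m * kk) *
        ((Equiv.Perm.sign κ : ℤ) ^ kk * ∏ i, (Equiv.Perm.sign (π i) : ℤ)) ^ m := by
  rw [relabel_eq_prodCongr_mul, Equiv.Perm.sign_mul, Equiv.Perm.sign_prodCongrLeft,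
    Equiv.Perm.sign_prodCongrRight]
  simp only [Equiv.Perm.sign_mul, Equiv.Perm.sign_prodCongrLeft, Equiv.Perm.sign_prodCongrRight,
    Finset.prod_const, Finset.card_univ, Fintype.card_prod, Fintype.card_fin, Units.val_mul,
    Units.val_pow_eq_pow_val, Units.coe_prod]

/-- **The relabelling substitution, with its factor**: the permutation matrix of
`(relabel ρ κ π)⁻¹` acts on `E(X)` as `rename (relabel ρ κ π)`, i.e. by the scalar
`(sign κ · sign ρ)^{k^m}`. [cite: MulmuleySohoniSIAM2001, Prop. 7.1 (AV p.31)] -/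
theorem linSubst_relabel_permMatrix_msE (ρ κ : Equiv.Perm (Fin m)) (π : Fin m → Equiv.Perm (Fin kk)) :
    linSubst (Fin m × (Fin m × Fin kk)) F (Equiv.Perm.permMatrix F (relabel ρ κ π).symm) (msE F m kk) =
      C ((((Equiv.Perm.sign κ : ℤ) : F) * ((Equiv.Perm.sign ρ : ℤ) : F)) ^
          Fintype.card (Fin m → Fin kk)) * msE F m kk := by
  rw [linSubst_permMatrix, Equiv.symm_symm, rename_relabel_msE]

/-- **Relabellings with `sign ρ = sign κ` fix `E(X)`** (the signs of the row permutation and of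
the block permutation cancel in every factor). [cite: MulmuleySohoniSIAM2001, Prop. 7.1 (AV p.31)] -/
theorem linSubst_relabel_permMatrix_msE_of_sign_eq {ρ κ : Equiv.Perm (Fin m)}
    (π : Fin m → Equiv.Perm (Fin kk)) (h : Equiv.Perm.sign ρ = Equiv.Perm.sign κ) :
    linSubst (Fin m × (Fin m × Fin kk)) F (Equiv.Perm.permMatrix F (relabel ρ κ π).symm) (msE F m kk) =
      msE F m kk := by
  rw [linSubst_relabel_permMatrix_msE, ← h, ← Int.cast_mul, ← Units.val_mul, Int.units_mul_self,
    Units.val_one, Int.cast_one, one_pow, C_1, one_mul]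

/-- The determinant of the relabelling permutation matrix is the sign of the relabelling.
[cite: HornJohnson2013, §0.9.5 (permutation matrices)] -/
theorem det_relabel_permMatrix (ρ κ : Equiv.Perm (Fin m)) (π : Fin m → Equiv.Perm (Fin kk)) :
    (Equiv.Perm.permMatrix F (relabel ρ κ π).symm).det =
      (((Equiv.Perm.sign ρ : ℤ) ^ (m * kk) *
        ((Equiv.Perm.sign κ : ℤ) ^ kk * ∏ i, (Equiv.Perm.sign (π i) : ℤ)) ^ m : ℤ) : F) := by
  rw [Matrix.det_permutation, Equiv.Perm.sign_symm, sign_relabel]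

/-- **Determinant-one relabellings**: if `sign ρ = sign κ` and `∏_i sign π_i = 1`, the
relabelling permutation matrix lies in `SL_{km²}`. [cite: HornJohnson2013, §0.9.5 (permutation matrices)] -/
theorem det_relabel_permMatrix_eq_one {ρ κ : Equiv.Perm (Fin m)} {π : Fin m → Equiv.Perm (Fin kk)}
    (h1 : Equiv.Perm.sign ρ = Equiv.Perm.sign κ) (h2 : ∏ i, Equiv.Perm.sign (π i) = 1) :
    (Equiv.Perm.permMatrix F (relabel ρ κ π).symm).det = 1 := by
  rw [det_relabel_permMatrix, h1, ← Units.coe_prod, h2, Units.val_one, mul_one, ← pow_mul,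
    mul_comm kk m, ← pow_add, ← two_mul, pow_mul, pow_two, Int.units_coe_mul_self, one_pow,
    Int.cast_one]

/-- The permutation matrix of `e⁻¹` moves the elementary vector `e_x` to `e_{e x}`.
[cite: HornJohnson2013, §0.9.5 (permutation matrices)] -/
theorem permMatrix_symm_mulVec_single {ι : Type*} [Fintype ι] [DecidableEq ι] (e : Equiv.Perm ι)
    (x : ι) (a : F) :
    (Equiv.Perm.permMatrix F e.symm).mulVec (Pi.single x a : ι → F) = Pi.single (e x) a := by
  rw [Matrix.permMatrix_mulVec]
  funext v
  simp only [Function.comp_apply, Pi.single_apply, Equiv.symm_apply_eq]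

end MS2001FormE

end Literature.Computability.AlgebraicComplexity

end
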